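import Mathlib
import Literature.NumberTheory.LFunctions.NumHelpers
import Summits.QuantumFields.BalabanUV.Beta.EriceRemainderEnclosureHistoryAutonomyComparisonAgeCompositionStaticChainAdjacentRatioEnvelopes
import Summits.QuantumFields.BalabanUV.Beta.EriceRemainderEnclosureHistoryAutonomyComparisonAgeCompositionStaticChainBandsMid
import Summits.QuantumFields.BalabanUV.Beta.EriceRemainderEnclosureHistoryAutonomyComparisonAgeCompositionStaticChainBandStepLatticeHalf
import Summits.QuantumFields.BalabanUV.Beta.EriceRemainderEnclosureHistoryAutonomyComparisonAgeCompositionStaticChainBandsE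
import Summits.QuantumFields.BalabanUV.Beta.EriceRemainderEnclosureHistoryAutonomyComparisonAgeCompositionStaticChainBandsF
import Summits.QuantumFields.BalabanUV.Beta.EriceRemainderEnclosureHistoryAutonomyComparisonAgeCompositionStaticChainBandsG
import Summits.QuantumFields.BalabanUV.Beta.EriceRemainderEnclosureHistoryAutonomyComparisonAgeCompositionStaticChainBandsH
import Summits.QuantumFields.BalabanUV.Beta.EriceRemainderEnclosureHistoryAutonomyComparisonAgeCompositionStaticChainBandsJ

/-!
# EriceRemainderEnclosureHistoryAutonomyComparisonAgeCompositionStaticChainBandsLow — (E79za) THE LOW-THRESHOLD BAND CAPSTONES (halved covariance constant):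
# the observer step (◆) above every NON-ADJACENT pair with `7∕40 ≤ z∕y ≤ 3∕4` and `y ≥ 8`; with `3∕4 ≤ z∕y ≤ 17∕20` or `3∕20 ≤ z∕y ≤ 7∕40` and `y ≥ 12`; with
# `17∕20 ≤ z∕y ≤ 19∕20` and `y ≥ 16` — leaving, below `q = 8`, only the 27 residual pairs of (E79y)

Cell `pub-balaban`, β-function sub-cell, BINDER row D4 «RemainderConst leaves for Bałaban's split» (`HOME/BINDER-OWNERS.md`; owner lineage `b2b-balaban-beta-an4`;
this file by co-owner #2 lineage `b2b-balaban-beta-d4-p2`, generation 70), β-FLOW TEAM duty (1), FREEZE (0) honoured (def-free; imports (E79q) `…BandStepLatticeHalf`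
(`band_pair_step_lattice_half`), the half-constant packages (E79r∕s) `…BandsE∕F`, (E79u∕v∕x) `…BandsG∕H∕J`, (E79n) `…BandsMid` (`thetabar_le_band`), (E78f)
`thetabar_le_envelope`; nothing restated).

HONEST FRAMING (page 1, verbatim and binding).  *"Discharging BetaPertH makes Bałaban's UV stability UNCONDITIONAL — a real constructive-QFT result; it is
NOT the continuum limit and NOT the Clay problem."*  THIS FILE DISCHARGES NOTHING OF THE KIND.  Case analysis on a rational ratio plus tree theorems —
hypotheses of a census, not facts; the age profile of Bałaban's (1.22) limit functional is NOT PRINTED ([I] p. 298; GAPS G-t4-U2-1∕-2) and NOT asserted.  Row D4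
class UNCHANGED (critical-path width 0; instance 0∕1; D4 DISCHARGE NO DATE).  HONEST DEPENDENCY: continuum YM on T⁴ ⇐ BetaPertH ∧ nine spine estimates (0/9
proved); BetaPertH ⇐ (D1) ∧ (D4) ∧ CAP+tail; G-an2-4 gates asym, D1 and NE2/3/4.

THE POINT (census sense (α); route (N′); README `HOME/b2b-balaban-beta-d4-p2/g70/e79/README.md` §4).  (E79t) `band_step_lattice_ge_eighth` needs `y ≥ 24`.  With
the covariance constant halved (E79h∕q) and two-square certificates for the one corner with negative middle coefficients, the provable envelopes close the bands
much lower (`numerics/band2.py -half`): this file assembles the low-threshold packages into §1 `band_step_lattice_low8` (`7∕40 ≤ z∕y ≤ 3∕4`, `y ≥ 8`; fourteen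
bands), §2 `band_step_lattice_low12` (`3∕4 ≤ z∕y ≤ 17∕20`, `y ≥ 12`), §3 `band_step_lattice_low12b` (`3∕20 ≤ z∕y ≤ 7∕40`, `y ≥ 12`), §4 `band_step_lattice_low16`
(`17∕20 ≤ z∕y ≤ 19∕20`, `y ≥ 16`) — each for every NON-ADJACENT pair (`z + 2 ≤ y`) of its range, every level-coupled configuration, every admissible load,
natural defect hypothesis `θ ≤ θ̄(y∕z)`.  CONSEQUENCE (enumeration in NOTES∕README): together with (E79g) (adjacent, all `z`), (E79t) (`y ≥ 24`, `q ≤ 8`) and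
these, EVERY pair with `q = y∕z ≤ 8` is covered EXCEPT the 27 residual pairs `(3,1) … (23,3)` served one by one by the pair template (E79y) and its packages
(E79z1–z6).  NOT CLAIMED: the union theorem over all pairs `q ≤ 8` (successor: a finite dispatch); `q > 8`; anything printed.

WHAT IS PROVED ([folklore]; 0 `def`, 0 sorry).  `band_step_lattice_low8`, `band_step_lattice_low12`, `band_step_lattice_low12b`, `band_step_lattice_low16`.
-/
noncomputable section
open Finset

namespace Summit.QuantumFields.BalabanUV.Beta.EriceRemainderEnclosureHistoryAutonomyComparisonAgeCompositionStaticChainBandsLow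

open Summit.QuantumFields.BalabanUV.Beta.EriceRemainderEnclosureHistoryAutonomyComparisonAgeCompositionStaticChainAdjacentRatioEnvelopes
open Summit.QuantumFields.BalabanUV.Beta.EriceRemainderEnclosureHistoryAutonomyComparisonAgeCompositionStaticChainBandsMid
open Summit.QuantumFields.BalabanUV.Beta.EriceRemainderEnclosureHistoryAutonomyComparisonAgeCompositionStaticChainBandStepLatticeHalf
open Literature.NumberTheory.LFunctions.VdC.Num (le_sqrt_of_sq_le)

/-- **THE OBSERVER STEP (◆) ABOVE EVERY NON-ADJACENT PAIR WITH `7∕40·y ≤ z ≤ 3∕4·y`, `y ≥ 8`** (`q ∈ [1.33, 5.71]`), every configuration, every admissible load, natural defect hypothesis: fourteen half-constant packages of (E79r∕s∕u∕v) through (E79q) `band_pair_step_lattice_half`. [folklore] -/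
theorem band_step_lattice_low8 {n y z : ℕ} {k : ℕ → ℕ} {x a cy cz Sy Sz Ry Rz : ℕ → ℝ} {θ xy Ψyy Ψyz Ψzy Ψzz Ωz σ φ s : ℝ}
    (hy : 8 ≤ y) (hlo : (7/40:ℝ) * y ≤ z) (hhi : (z : ℝ) ≤ (3/4:ℝ) * y) (hzy2 : z + 2 ≤ y)
    (hn : 0 < n) (hk : ∀ l, l < n → y + 1 ≤ k l) (hx : ∀ l, l < n → 0 ≤ x l)
    (hSy : ∀ l, l < n → Sy l = ∑ m ∈ range y, Real.sqrt ((k l : ℝ) / ((k l : ℝ) + m + 1)))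
    (hSz : ∀ l, l < n → Sz l = ∑ m ∈ range z, Real.sqrt ((k l : ℝ) / ((k l : ℝ) + m + 1)))
    (hRy : ∀ l, l < n → Ry l = ∑ m ∈ range (k l), Real.sqrt ((y : ℝ) / ((y : ℝ) + m + 1)))
    (hRz : ∀ l, l < n → Rz l = ∑ m ∈ range (k l), Real.sqrt ((z : ℝ) / ((z : ℝ) + m + 1)))
    (ha0 : ∀ i, i < n → 0 < a i)
    (ha : ∀ i, i < n → a i = 1 + ∑ l ∈ range n,
      (2 * x l * (∑ m ∈ range (k i), Real.sqrt ((k l : ℝ) / ((k l : ℝ) + m + 1))) / k l) * a l)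
    (hcy : ∀ i, i < n → cy i = Ry i / (y : ℝ) + ∑ l ∈ range n,
      (2 * x l * (∑ m ∈ range (k i), Real.sqrt ((k l : ℝ) / ((k l : ℝ) + m + 1))) / k l) * cy l)
    (hcz : ∀ i, i < n → cz i = Rz i / (z : ℝ) + ∑ l ∈ range n,
      (2 * x l * (∑ m ∈ range (k i), Real.sqrt ((k l : ℝ) / ((k l : ℝ) + m + 1))) / k l) * cz l)
    (hΨyy : Ψyy = ∑ l ∈ range n, (2 * x l * Sy l / k l) * cy l) (hΨyz : Ψyz = ∑ l ∈ range n, (2 * x l * Sz l / k l) * cy l)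
    (hΨzy : Ψzy = ∑ l ∈ range n, (2 * x l * Sy l / k l) * cz l) (hΨzz : Ψzz = ∑ l ∈ range n, (2 * x l * Sz l / k l) * cz l)
    (hΩz : Ωz = ∑ l ∈ range n, x l * (z : ℝ) / k l)
    (hσ : σ = (∑ m ∈ range z, Real.sqrt ((y : ℝ) / ((y : ℝ) + m + 1))) / (y : ℝ))
    (hφ : φ = (∑ m ∈ range y, Real.sqrt ((z : ℝ) / ((z : ℝ) + m + 1))) / (z : ℝ))
    (hs : s = (∑ m ∈ range y, Real.sqrt ((y : ℝ) / ((y : ℝ) + m + 1))) / (y : ℝ))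
    (hθ : θ ≤ 1 - ((y : ℝ) / z) / ((y : ℝ) / z + 1) * Real.sqrt (((y : ℝ) / z) / ((y : ℝ) / z + 1)) * Real.exp (-(1 / (2 * ((y : ℝ) / z)))))
    (hxy : 0 ≤ xy) (hcap : 2 * xy * (s + Ψyy) < 1) :
    (1 + 2 * (31/40:ℝ) * Ψzz) * (1 - Ωz) - (1 - θ) * (xy * (1 + 2 * (31/40:ℝ) * Ψyy))
      ≤ (1 - xy * (1 + 2 * (31/40:ℝ) * Ψyy)) *
        ((1 + 2 * (31/40:ℝ) * Ψzz + 4 * (31/40:ℝ) * xy * ((σ + Ψyz) * (φ + Ψzy)) / (1 - 2 * (s + Ψyy) * xy)) * ((1 - Ωz) - xy / ((y : ℝ) / (z : ℝ)))) := by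
  have hy' : (8 : ℝ) ≤ y := by exact_mod_cast hy
  have hz1 : 1 ≤ z := by
    by_contra h
    have : (z : ℝ) ≤ 0 := by exact_mod_cast (show z ≤ 0 by omega)
    linarith
  have hzp : (0 : ℝ) < z := by exact_mod_cast (show 0 < z by omega)
  have hzy : z + 1 ≤ y := by omega
  have hq1 : (1 : ℝ) ≤ (y : ℝ) / z := by
    rw [le_div_iff₀ hzp]
    have : (z : ℝ) + 1 ≤ y := by exact_mod_cast hzy
    linarith
  by_cases c0 : (z : ℝ) ≤ (1/5:ℝ) * y
  · have hzlo : 2 ≤ z := by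
      by_contra h
      have : (z : ℝ) ≤ 1 := by exact_mod_cast (show z ≤ 1 by omega)
      linarith [show (7/40:ℝ) * (y : ℝ) ≤ z from hlo]
    exact band_pair_step_lattice_half (rl := (7/40:ℝ)) (rh := (1/5:ℝ)) (y0 := 8) (z0 := 2) (th := (1577/5000:ℝ)) (by norm_num) (by norm_num) (by omega) hzlo hz1 hzy hlo c0 Summit.QuantumFields.BalabanUV.Beta.EriceRemainderEnclosureHistoryAutonomyComparisonAgeCompositionStaticChainBandsF.facts_band_7_40_to_1_5
      hn hk hx hSy hSz hRy hRz ha0 ha hcy hcz hΨyy hΨyz hΨzy hΨzz hΩz hσ hφ hs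
      (hθ.trans (thetabar_le_band (ql := (5:ℝ)) (Lc := (91287/100000:ℝ)) (by norm_num) (by rw [le_div_iff₀ hzp]; linarith) (le_sqrt_of_sq_le (by norm_num) (by norm_num)) (by norm_num) (by norm_num))) hxy hcap
  by_cases c1 : (z : ℝ) ≤ (9/40:ℝ) * y
  · have hzlo : 2 ≤ z := by
      by_contra h
      have : (z : ℝ) ≤ 1 := by exact_mod_cast (show z ≤ 1 by omega)
      linarith [show (1/5:ℝ) * (y : ℝ) ≤ z from (not_le.mp c0).le]
    exact band_pair_step_lattice_half (rl := (1/5:ℝ)) (rh := (9/40:ℝ)) (y0 := 8) (z0 := 2) (th := (691/2000:ℝ)) (by norm_num) (by norm_num) (by omega) hzlo hz1 hzy (not_le.mp c0).le c1 Summit.QuantumFields.BalabanUV.Beta.EriceRemainderEnclosureHistoryAutonomyComparisonAgeCompositionStaticChainBandsE.facts_band_1_5_to_9_40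
      hn hk hx hSy hSz hRy hRz ha0 ha hcy hcz hΨyy hΨyz hΨzy hΨzz hΩz hσ hφ hs
      (hθ.trans (thetabar_le_band (ql := (40/9:ℝ)) (Lc := (903507/1000000:ℝ)) (by norm_num) (by rw [le_div_iff₀ hzp]; linarith) (le_sqrt_of_sq_le (by norm_num) (by norm_num)) (by norm_num) (by norm_num))) hxy hcap
  by_cases c2 : (z : ℝ) ≤ (1/4:ℝ) * y
  · have hzlo : 2 ≤ z := by
      by_contra h
      have : (z : ℝ) ≤ 1 := by exact_mod_cast (show z ≤ 1 by omega)
      linarith [show (9/40:ℝ) * (y : ℝ) ≤ z from (not_le.mp c1).le]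
    exact band_pair_step_lattice_half (rl := (9/40:ℝ)) (rh := (1/4:ℝ)) (y0 := 8) (z0 := 2) (th := (187/500:ℝ)) (by norm_num) (by norm_num) (by omega) hzlo hz1 hzy (not_le.mp c1).le c2 Summit.QuantumFields.BalabanUV.Beta.EriceRemainderEnclosureHistoryAutonomyComparisonAgeCompositionStaticChainBandsE.facts_band_9_40_to_1_4
      hn hk hx hSy hSz hRy hRz ha0 ha hcy hcz hΨyy hΨyz hΨzy hΨzz hΩz hσ hφ hs
      (hθ.trans (thetabar_le_band (ql := (4:ℝ)) (Lc := (894427/1000000:ℝ)) (by norm_num) (by rw [le_div_iff₀ hzp]; linarith) (le_sqrt_of_sq_le (by norm_num) (by norm_num)) (by norm_num) (by norm_num))) hxy hcap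
  by_cases c3 : (z : ℝ) ≤ (11/40:ℝ) * y
  · have hzlo : 2 ≤ z := by
      by_contra h
      have : (z : ℝ) ≤ 1 := by exact_mod_cast (show z ≤ 1 by omega)
      linarith [show (1/4:ℝ) * (y : ℝ) ≤ z from (not_le.mp c2).le]
    exact band_pair_step_lattice_half (rl := (1/4:ℝ)) (rh := (11/40:ℝ)) (y0 := 8) (z0 := 2) (th := (401/1000:ℝ)) (by norm_num) (by norm_num) (by omega) hzlo hz1 hzy (not_le.mp c2).le c3 Summit.QuantumFields.BalabanUV.Beta.EriceRemainderEnclosureHistoryAutonomyComparisonAgeCompositionStaticChainBandsE.facts_band_1_4_to_11_40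
      hn hk hx hSy hSz hRy hRz ha0 ha hcy hcz hΨyy hΨyz hΨzy hΨzz hΩz hσ hφ hs
      (hθ.trans (thetabar_le_band (ql := (40/11:ℝ)) (Lc := (442807/500000:ℝ)) (by norm_num) (by rw [le_div_iff₀ hzp]; linarith) (le_sqrt_of_sq_le (by norm_num) (by norm_num)) (by norm_num) (by norm_num))) hxy hcap
  by_cases c4 : (z : ℝ) ≤ (3/10:ℝ) * y
  · have hzlo : 3 ≤ z := by
      by_contra h
      have : (z : ℝ) ≤ 2 := by exact_mod_cast (show z ≤ 2 by omega)
      linarith [show (11/40:ℝ) * (y : ℝ) ≤ z from (not_le.mp c3).le]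
    exact band_pair_step_lattice_half (rl := (11/40:ℝ)) (rh := (3/10:ℝ)) (y0 := 8) (z0 := 3) (th := (2133/5000:ℝ)) (by norm_num) (by norm_num) (by omega) hzlo hz1 hzy (not_le.mp c3).le c4 Summit.QuantumFields.BalabanUV.Beta.EriceRemainderEnclosureHistoryAutonomyComparisonAgeCompositionStaticChainBandsE.facts_band_11_40_to_3_10
      hn hk hx hSy hSz hRy hRz ha0 ha hcy hcz hΨyy hΨyz hΨzy hΨzz hΩz hσ hφ hs
      (hθ.trans (thetabar_le_band (ql := (10/3:ℝ)) (Lc := (438529/500000:ℝ)) (by norm_num) (by rw [le_div_iff₀ hzp]; linarith) (le_sqrt_of_sq_le (by norm_num) (by norm_num)) (by norm_num) (by norm_num))) hxy hcap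
  by_cases c5 : (z : ℝ) ≤ (7/20:ℝ) * y
  · have hzlo : 3 ≤ z := by
      by_contra h
      have : (z : ℝ) ≤ 2 := by exact_mod_cast (show z ≤ 2 by omega)
      linarith [show (3/10:ℝ) * (y : ℝ) ≤ z from (not_le.mp c4).le]
    exact band_pair_step_lattice_half (rl := (3/10:ℝ)) (rh := (7/20:ℝ)) (y0 := 8) (z0 := 3) (th := (4741/10000:ℝ)) (by norm_num) (by norm_num) (by omega) hzlo hz1 hzy (not_le.mp c4).le c5 Summit.QuantumFields.BalabanUV.Beta.EriceRemainderEnclosureHistoryAutonomyComparisonAgeCompositionStaticChainBandsH.facts_low_3_10_to_7_20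
      hn hk hx hSy hSz hRy hRz ha0 ha hcy hcz hΨyy hΨyz hΨzy hΨzz hΩz hσ hφ hs
      (hθ.trans (thetabar_le_band (ql := (20/7:ℝ)) (Lc := (430331/500000:ℝ)) (by norm_num) (by rw [le_div_iff₀ hzp]; linarith) (le_sqrt_of_sq_le (by norm_num) (by norm_num)) (by norm_num) (by norm_num))) hxy hcap
  by_cases c6 : (z : ℝ) ≤ (2/5:ℝ) * y
  · have hzlo : 3 ≤ z := by
      by_contra h
      have : (z : ℝ) ≤ 2 := by exact_mod_cast (show z ≤ 2 by omega)
      linarith [show (7/20:ℝ) * (y : ℝ) ≤ z from (not_le.mp c5).le]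
    exact band_pair_step_lattice_half (rl := (7/20:ℝ)) (rh := (2/5:ℝ)) (y0 := 8) (z0 := 3) (th := (5171/10000:ℝ)) (by norm_num) (by norm_num) (by omega) hzlo hz1 hzy (not_le.mp c5).le c6 Summit.QuantumFields.BalabanUV.Beta.EriceRemainderEnclosureHistoryAutonomyComparisonAgeCompositionStaticChainBandsH.facts_low_7_20_to_2_5
      hn hk hx hSy hSz hRy hRz ha0 ha hcy hcz hΨyy hΨyz hΨzy hΨzz hΩz hσ hφ hs
      (hθ.trans (thetabar_le_band (ql := (5/2:ℝ)) (Lc := (422577/500000:ℝ)) (by norm_num) (by rw [le_div_iff₀ hzp]; linarith) (le_sqrt_of_sq_le (by norm_num) (by norm_num)) (by norm_num) (by norm_num))) hxy hcap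
  by_cases c7 : (z : ℝ) ≤ (9/20:ℝ) * y
  · have hzlo : 4 ≤ z := by
      by_contra h
      have : (z : ℝ) ≤ 3 := by exact_mod_cast (show z ≤ 3 by omega)
      linarith [show (2/5:ℝ) * (y : ℝ) ≤ z from (not_le.mp c6).le]
    exact band_pair_step_lattice_half (rl := (2/5:ℝ)) (rh := (9/20:ℝ)) (y0 := 8) (z0 := 4) (th := (2781/5000:ℝ)) (by norm_num) (by norm_num) (by omega) hzlo hz1 hzy (not_le.mp c6).le c7 Summit.QuantumFields.BalabanUV.Beta.EriceRemainderEnclosureHistoryAutonomyComparisonAgeCompositionStaticChainBandsH.facts_low_2_5_to_9_20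
      hn hk hx hSy hSz hRy hRz ha0 ha hcy hcz hΨyy hΨyz hΨzy hΨzz hΩz hσ hφ hs
      (hθ.trans (thetabar_le_band (ql := (20/9:ℝ)) (Lc := (415227/500000:ℝ)) (by norm_num) (by rw [le_div_iff₀ hzp]; linarith) (le_sqrt_of_sq_le (by norm_num) (by norm_num)) (by norm_num) (by norm_num))) hxy hcap
  by_cases c8 : (z : ℝ) ≤ (1/2:ℝ) * y
  · have hzlo : 4 ≤ z := by
      by_contra h
      have : (z : ℝ) ≤ 3 := by exact_mod_cast (show z ≤ 3 by omega)
      linarith [show (9/20:ℝ) * (y : ℝ) ≤ z from (not_le.mp c7).le]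
    exact band_pair_step_lattice_half (rl := (9/20:ℝ)) (rh := (1/2:ℝ)) (y0 := 8) (z0 := 4) (th := (2959/5000:ℝ)) (by norm_num) (by norm_num) (by omega) hzlo hz1 hzy (not_le.mp c7).le c8 Summit.QuantumFields.BalabanUV.Beta.EriceRemainderEnclosureHistoryAutonomyComparisonAgeCompositionStaticChainBandsH.facts_low_9_20_to_1_2
      hn hk hx hSy hSz hRy hRz ha0 ha hcy hcz hΨyy hΨyz hΨzy hΨzz hΩz hσ hφ hs
      (hθ.trans (thetabar_le_band (ql := (2:ℝ)) (Lc := (51031/62500:ℝ)) (by norm_num) (by rw [le_div_iff₀ hzp]; linarith) (le_sqrt_of_sq_le (by norm_num) (by norm_num)) (by norm_num) (by norm_num))) hxy hcap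
  by_cases c9 : (z : ℝ) ≤ (11/20:ℝ) * y
  · have hzlo : 4 ≤ z := by
      by_contra h
      have : (z : ℝ) ≤ 3 := by exact_mod_cast (show z ≤ 3 by omega)
      linarith [show (1/2:ℝ) * (y : ℝ) ≤ z from (not_le.mp c8).le]
    exact band_pair_step_lattice_half (rl := (1/2:ℝ)) (rh := (11/20:ℝ)) (y0 := 8) (z0 := 4) (th := (1561/2500:ℝ)) (by norm_num) (by norm_num) (by omega) hzlo hz1 hzy (not_le.mp c8).le c9 Summit.QuantumFields.BalabanUV.Beta.EriceRemainderEnclosureHistoryAutonomyComparisonAgeCompositionStaticChainBandsG.facts_low_1_2_to_11_20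
      hn hk hx hSy hSz hRy hRz ha0 ha hcy hcz hΨyy hΨyz hΨzy hΨzz hΩz hσ hφ hs
      (hθ.trans (thetabar_le_band (ql := (20/11:ℝ)) (Lc := (803219/1000000:ℝ)) (by norm_num) (by rw [le_div_iff₀ hzp]; linarith) (le_sqrt_of_sq_le (by norm_num) (by norm_num)) (by norm_num) (by norm_num))) hxy hcap
  by_cases c10 : (z : ℝ) ≤ (3/5:ℝ) * y
  · have hzlo : 5 ≤ z := by
      by_contra h
      have : (z : ℝ) ≤ 4 := by exact_mod_cast (show z ≤ 4 by omega)
      linarith [show (11/20:ℝ) * (y : ℝ) ≤ z from (not_le.mp c9).le]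
    exact band_pair_step_lattice_half (rl := (11/20:ℝ)) (rh := (3/5:ℝ)) (y0 := 8) (z0 := 5) (th := (3271/5000:ℝ)) (by norm_num) (by norm_num) (by omega) hzlo hz1 hzy (not_le.mp c9).le c10 Summit.QuantumFields.BalabanUV.Beta.EriceRemainderEnclosureHistoryAutonomyComparisonAgeCompositionStaticChainBandsG.facts_low_11_20_to_3_5
      hn hk hx hSy hSz hRy hRz ha0 ha hcy hcz hΨyy hΨyz hΨzy hΨzz hΩz hσ hφ hs
      (hθ.trans (thetabar_le_band (ql := (5/3:ℝ)) (Lc := (790569/1000000:ℝ)) (by norm_num) (by rw [le_div_iff₀ hzp]; linarith) (le_sqrt_of_sq_le (by norm_num) (by norm_num)) (by norm_num) (by norm_num))) hxy hcap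
  by_cases c11 : (z : ℝ) ≤ (13/20:ℝ) * y
  · have hzlo : 5 ≤ z := by
      by_contra h
      have : (z : ℝ) ≤ 4 := by exact_mod_cast (show z ≤ 4 by omega)
      linarith [show (3/5:ℝ) * (y : ℝ) ≤ z from (not_le.mp c10).le]
    exact band_pair_step_lattice_half (rl := (3/5:ℝ)) (rh := (13/20:ℝ)) (y0 := 8) (z0 := 5) (th := (426/625:ℝ)) (by norm_num) (by norm_num) (by omega) hzlo hz1 hzy (not_le.mp c10).le c11 Summit.QuantumFields.BalabanUV.Beta.EriceRemainderEnclosureHistoryAutonomyComparisonAgeCompositionStaticChainBandsG.facts_low_3_5_to_13_20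
      hn hk hx hSy hSz hRy hRz ha0 ha hcy hcz hΨyy hΨyz hΨzy hΨzz hΩz hσ hφ hs
      (hθ.trans (thetabar_le_band (ql := (20/13:ℝ)) (Lc := (389249/500000:ℝ)) (by norm_num) (by rw [le_div_iff₀ hzp]; linarith) (le_sqrt_of_sq_le (by norm_num) (by norm_num)) (by norm_num) (by norm_num))) hxy hcap
  by_cases c12 : (z : ℝ) ≤ (7/10:ℝ) * y
  · have hzlo : 6 ≤ z := by
      by_contra h
      have : (z : ℝ) ≤ 5 := by exact_mod_cast (show z ≤ 5 by omega)
      linarith [show (13/20:ℝ) * (y : ℝ) ≤ z from (not_le.mp c11).le]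
    exact band_pair_step_lattice_half (rl := (13/20:ℝ)) (rh := (7/10:ℝ)) (y0 := 8) (z0 := 6) (th := (1767/2500:ℝ)) (by norm_num) (by norm_num) (by omega) hzlo hz1 hzy (not_le.mp c11).le c12 Summit.QuantumFields.BalabanUV.Beta.EriceRemainderEnclosureHistoryAutonomyComparisonAgeCompositionStaticChainBandsG.facts_low_13_20_to_7_10
      hn hk hx hSy hSz hRy hRz ha0 ha hcy hcz hΨyy hΨyz hΨzy hΨzz hΩz hσ hφ hs
      (hθ.trans (thetabar_le_band (ql := (10/7:ℝ)) (Lc := (191741/250000:ℝ)) (by norm_num) (by rw [le_div_iff₀ hzp]; linarith) (le_sqrt_of_sq_le (by norm_num) (by norm_num)) (by norm_num) (by norm_num))) hxy hcap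
  have hzlo : 6 ≤ z := by
    by_contra h
    have : (z : ℝ) ≤ 5 := by exact_mod_cast (show z ≤ 5 by omega)
    linarith [show (7/10:ℝ) * (y : ℝ) ≤ z from (not_le.mp c12).le]
  exact band_pair_step_lattice_half (rl := (7/10:ℝ)) (rh := (3/4:ℝ)) (y0 := 8) (z0 := 6) (th := (7301/10000:ℝ)) (by norm_num) (by norm_num) (by omega) hzlo hz1 hzy (not_le.mp c12).le hhi Summit.QuantumFields.BalabanUV.Beta.EriceRemainderEnclosureHistoryAutonomyComparisonAgeCompositionStaticChainBandsG.facts_low_7_10_to_3_4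
    hn hk hx hSy hSz hRy hRz ha0 ha hcy hcz hΨyy hΨyz hΨzy hΨzz hΩz hσ hφ hs
    (hθ.trans (thetabar_le_band (ql := (4/3:ℝ)) (Lc := (94491/125000:ℝ)) (by norm_num) (by rw [le_div_iff₀ hzp]; linarith) (le_sqrt_of_sq_le (by norm_num) (by norm_num)) (by norm_num) (by norm_num))) hxy hcap


/-- **THE OBSERVER STEP ABOVE EVERY NON-ADJACENT PAIR WITH `3∕4·y ≤ z ≤ 17∕20·y`, `y ≥ 12`**: the two packages of (E79x). [folklore] -/
theorem band_step_lattice_low12 {n y z : ℕ} {k : ℕ → ℕ} {x a cy cz Sy Sz Ry Rz : ℕ → ℝ} {θ xy Ψyy Ψyz Ψzy Ψzz Ωz σ φ s : ℝ}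
    (hy : 12 ≤ y) (hlo : (3/4:ℝ) * y ≤ z) (hhi : (z : ℝ) ≤ (17/20:ℝ) * y) (hzy2 : z + 2 ≤ y)
    (hn : 0 < n) (hk : ∀ l, l < n → y + 1 ≤ k l) (hx : ∀ l, l < n → 0 ≤ x l)
    (hSy : ∀ l, l < n → Sy l = ∑ m ∈ range y, Real.sqrt ((k l : ℝ) / ((k l : ℝ) + m + 1)))
    (hSz : ∀ l, l < n → Sz l = ∑ m ∈ range z, Real.sqrt ((k l : ℝ) / ((k l : ℝ) + m + 1)))
    (hRy : ∀ l, l < n → Ry l = ∑ m ∈ range (k l), Real.sqrt ((y : ℝ) / ((y : ℝ) + m + 1)))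
    (hRz : ∀ l, l < n → Rz l = ∑ m ∈ range (k l), Real.sqrt ((z : ℝ) / ((z : ℝ) + m + 1)))
    (ha0 : ∀ i, i < n → 0 < a i)
    (ha : ∀ i, i < n → a i = 1 + ∑ l ∈ range n,
      (2 * x l * (∑ m ∈ range (k i), Real.sqrt ((k l : ℝ) / ((k l : ℝ) + m + 1))) / k l) * a l)
    (hcy : ∀ i, i < n → cy i = Ry i / (y : ℝ) + ∑ l ∈ range n,
      (2 * x l * (∑ m ∈ range (k i), Real.sqrt ((k l : ℝ) / ((k l : ℝ) + m + 1))) / k l) * cy l)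
    (hcz : ∀ i, i < n → cz i = Rz i / (z : ℝ) + ∑ l ∈ range n,
      (2 * x l * (∑ m ∈ range (k i), Real.sqrt ((k l : ℝ) / ((k l : ℝ) + m + 1))) / k l) * cz l)
    (hΨyy : Ψyy = ∑ l ∈ range n, (2 * x l * Sy l / k l) * cy l) (hΨyz : Ψyz = ∑ l ∈ range n, (2 * x l * Sz l / k l) * cy l)
    (hΨzy : Ψzy = ∑ l ∈ range n, (2 * x l * Sy l / k l) * cz l) (hΨzz : Ψzz = ∑ l ∈ range n, (2 * x l * Sz l / k l) * cz l)
    (hΩz : Ωz = ∑ l ∈ range n, x l * (z : ℝ) / k l)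
    (hσ : σ = (∑ m ∈ range z, Real.sqrt ((y : ℝ) / ((y : ℝ) + m + 1))) / (y : ℝ))
    (hφ : φ = (∑ m ∈ range y, Real.sqrt ((z : ℝ) / ((z : ℝ) + m + 1))) / (z : ℝ))
    (hs : s = (∑ m ∈ range y, Real.sqrt ((y : ℝ) / ((y : ℝ) + m + 1))) / (y : ℝ))
    (hθ : θ ≤ 1 - ((y : ℝ) / z) / ((y : ℝ) / z + 1) * Real.sqrt (((y : ℝ) / z) / ((y : ℝ) / z + 1)) * Real.exp (-(1 / (2 * ((y : ℝ) / z)))))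
    (hxy : 0 ≤ xy) (hcap : 2 * xy * (s + Ψyy) < 1) :
    (1 + 2 * (31/40:ℝ) * Ψzz) * (1 - Ωz) - (1 - θ) * (xy * (1 + 2 * (31/40:ℝ) * Ψyy))
      ≤ (1 - xy * (1 + 2 * (31/40:ℝ) * Ψyy)) *
        ((1 + 2 * (31/40:ℝ) * Ψzz + 4 * (31/40:ℝ) * xy * ((σ + Ψyz) * (φ + Ψzy)) / (1 - 2 * (s + Ψyy) * xy)) * ((1 - Ωz) - xy / ((y : ℝ) / (z : ℝ)))) := by
  have hy' : (12 : ℝ) ≤ y := by exact_mod_cast hy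
  have hz1 : 1 ≤ z := by
    by_contra h
    have : (z : ℝ) ≤ 0 := by exact_mod_cast (show z ≤ 0 by omega)
    linarith
  have hzp : (0 : ℝ) < z := by exact_mod_cast (show 0 < z by omega)
  have hzy : z + 1 ≤ y := by omega
  have hq1 : (1 : ℝ) ≤ (y : ℝ) / z := by
    rw [le_div_iff₀ hzp]
    have : (z : ℝ) + 1 ≤ y := by exact_mod_cast hzy
    linarith
  by_cases c0 : (z : ℝ) ≤ (4/5:ℝ) * y
  · have hzlo : 9 ≤ z := by
      by_contra h
      have : (z : ℝ) ≤ 8 := by exact_mod_cast (show z ≤ 8 by omega)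
      linarith [show (3/4:ℝ) * (y : ℝ) ≤ z from hlo]
    exact band_pair_step_lattice_half (rl := (3/4:ℝ)) (rh := (4/5:ℝ)) (y0 := 12) (z0 := 9) (th := (1879/2500:ℝ)) (by norm_num) (by norm_num) (by omega) hzlo hz1 hzy hlo c0 Summit.QuantumFields.BalabanUV.Beta.EriceRemainderEnclosureHistoryAutonomyComparisonAgeCompositionStaticChainBandsJ.facts_low_3_4_to_4_5
      hn hk hx hSy hSz hRy hRz ha0 ha hcy hcz hΨyy hΨyz hΨzy hΨzz hΩz hσ hφ hs
      (hθ.trans (thetabar_le_band (ql := (5/4:ℝ)) (Lc := (149071/200000:ℝ)) (by norm_num) (by rw [le_div_iff₀ hzp]; linarith) (le_sqrt_of_sq_le (by norm_num) (by norm_num)) (by norm_num) (by norm_num))) hxy hcap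
  have hzlo : 10 ≤ z := by
    by_contra h
    have : (z : ℝ) ≤ 9 := by exact_mod_cast (show z ≤ 9 by omega)
    linarith [show (4/5:ℝ) * (y : ℝ) ≤ z from (not_le.mp c0).le]
  exact band_pair_step_lattice_half (rl := (4/5:ℝ)) (rh := (17/20:ℝ)) (y0 := 12) (z0 := 10) (th := (1543/2000:ℝ)) (by norm_num) (by norm_num) (by omega) hzlo hz1 hzy (not_le.mp c0).le hhi Summit.QuantumFields.BalabanUV.Beta.EriceRemainderEnclosureHistoryAutonomyComparisonAgeCompositionStaticChainBandsJ.facts_low_4_5_to_17_20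
    hn hk hx hSy hSz hRy hRz ha0 ha hcy hcz hΨyy hΨyz hΨzy hΨzz hΩz hσ hφ hs
    (hθ.trans (thetabar_le_band (ql := (20/17:ℝ)) (Lc := (367607/500000:ℝ)) (by norm_num) (by rw [le_div_iff₀ hzp]; linarith) (le_sqrt_of_sq_le (by norm_num) (by norm_num)) (by norm_num) (by norm_num))) hxy hcap


/-- **THE OBSERVER STEP ABOVE EVERY NON-ADJACENT PAIR WITH `3∕20·y ≤ z ≤ 7∕40·y`, `y ≥ 12`**: the package `facts_band_3_20_to_7_40` of (E79s). [folklore] -/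
theorem band_step_lattice_low12b {n y z : ℕ} {k : ℕ → ℕ} {x a cy cz Sy Sz Ry Rz : ℕ → ℝ} {θ xy Ψyy Ψyz Ψzy Ψzz Ωz σ φ s : ℝ}
    (hy : 12 ≤ y) (hlo : (3/20:ℝ) * y ≤ z) (hhi : (z : ℝ) ≤ (7/40:ℝ) * y) (hzy2 : z + 2 ≤ y)
    (hn : 0 < n) (hk : ∀ l, l < n → y + 1 ≤ k l) (hx : ∀ l, l < n → 0 ≤ x l)
    (hSy : ∀ l, l < n → Sy l = ∑ m ∈ range y, Real.sqrt ((k l : ℝ) / ((k l : ℝ) + m + 1)))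
    (hSz : ∀ l, l < n → Sz l = ∑ m ∈ range z, Real.sqrt ((k l : ℝ) / ((k l : ℝ) + m + 1)))
    (hRy : ∀ l, l < n → Ry l = ∑ m ∈ range (k l), Real.sqrt ((y : ℝ) / ((y : ℝ) + m + 1)))
    (hRz : ∀ l, l < n → Rz l = ∑ m ∈ range (k l), Real.sqrt ((z : ℝ) / ((z : ℝ) + m + 1)))
    (ha0 : ∀ i, i < n → 0 < a i)
    (ha : ∀ i, i < n → a i = 1 + ∑ l ∈ range n,
      (2 * x l * (∑ m ∈ range (k i), Real.sqrt ((k l : ℝ) / ((k l : ℝ) + m + 1))) / k l) * a l)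
    (hcy : ∀ i, i < n → cy i = Ry i / (y : ℝ) + ∑ l ∈ range n,
      (2 * x l * (∑ m ∈ range (k i), Real.sqrt ((k l : ℝ) / ((k l : ℝ) + m + 1))) / k l) * cy l)
    (hcz : ∀ i, i < n → cz i = Rz i / (z : ℝ) + ∑ l ∈ range n,
      (2 * x l * (∑ m ∈ range (k i), Real.sqrt ((k l : ℝ) / ((k l : ℝ) + m + 1))) / k l) * cz l)
    (hΨyy : Ψyy = ∑ l ∈ range n, (2 * x l * Sy l / k l) * cy l) (hΨyz : Ψyz = ∑ l ∈ range n, (2 * x l * Sz l / k l) * cy l)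
    (hΨzy : Ψzy = ∑ l ∈ range n, (2 * x l * Sy l / k l) * cz l) (hΨzz : Ψzz = ∑ l ∈ range n, (2 * x l * Sz l / k l) * cz l)
    (hΩz : Ωz = ∑ l ∈ range n, x l * (z : ℝ) / k l)
    (hσ : σ = (∑ m ∈ range z, Real.sqrt ((y : ℝ) / ((y : ℝ) + m + 1))) / (y : ℝ))
    (hφ : φ = (∑ m ∈ range y, Real.sqrt ((z : ℝ) / ((z : ℝ) + m + 1))) / (z : ℝ))
    (hs : s = (∑ m ∈ range y, Real.sqrt ((y : ℝ) / ((y : ℝ) + m + 1))) / (y : ℝ))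
    (hθ : θ ≤ 1 - ((y : ℝ) / z) / ((y : ℝ) / z + 1) * Real.sqrt (((y : ℝ) / z) / ((y : ℝ) / z + 1)) * Real.exp (-(1 / (2 * ((y : ℝ) / z)))))
    (hxy : 0 ≤ xy) (hcap : 2 * xy * (s + Ψyy) < 1) :
    (1 + 2 * (31/40:ℝ) * Ψzz) * (1 - Ωz) - (1 - θ) * (xy * (1 + 2 * (31/40:ℝ) * Ψyy))
      ≤ (1 - xy * (1 + 2 * (31/40:ℝ) * Ψyy)) *
        ((1 + 2 * (31/40:ℝ) * Ψzz + 4 * (31/40:ℝ) * xy * ((σ + Ψyz) * (φ + Ψzy)) / (1 - 2 * (s + Ψyy) * xy)) * ((1 - Ωz) - xy / ((y : ℝ) / (z : ℝ)))) := by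
  have hy' : (12 : ℝ) ≤ y := by exact_mod_cast hy
  have hz1 : 1 ≤ z := by
    by_contra h
    have : (z : ℝ) ≤ 0 := by exact_mod_cast (show z ≤ 0 by omega)
    linarith
  have hzp : (0 : ℝ) < z := by exact_mod_cast (show 0 < z by omega)
  have hzy : z + 1 ≤ y := by omega
  have hq1 : (1 : ℝ) ≤ (y : ℝ) / z := by
    rw [le_div_iff₀ hzp]
    have : (z : ℝ) + 1 ≤ y := by exact_mod_cast hzy
    linarith
  have hzlo : 2 ≤ z := by
    by_contra h
    have : (z : ℝ) ≤ 1 := by exact_mod_cast (show z ≤ 1 by omega)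
    linarith [show (3/20:ℝ) * (y : ℝ) ≤ z from hlo]
  exact band_pair_step_lattice_half (rl := (3/20:ℝ)) (rh := (7/40:ℝ)) (y0 := 12) (z0 := 2) (th := (709/2500:ℝ)) (by norm_num) (by norm_num) (by omega) hzlo hz1 hzy hlo hhi Summit.QuantumFields.BalabanUV.Beta.EriceRemainderEnclosureHistoryAutonomyComparisonAgeCompositionStaticChainBandsF.facts_band_3_20_to_7_40
    hn hk hx hSy hSz hRy hRz ha0 ha hcy hcz hΨyy hΨyz hΨzy hΨzz hΩz hσ hφ hs
    (hθ.trans (thetabar_le_band (ql := (40/7:ℝ)) (Lc := (922531/1000000:ℝ)) (by norm_num) (by rw [le_div_iff₀ hzp]; linarith) (le_sqrt_of_sq_le (by norm_num) (by norm_num)) (by norm_num) (by norm_num))) hxy hcap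


/-- **THE OBSERVER STEP ABOVE EVERY NON-ADJACENT PAIR WITH `17∕20·y ≤ z ≤ 19∕20·y`, `y ≥ 16`**: the two near-diagonal packages of (E79x). [folklore] -/
theorem band_step_lattice_low16 {n y z : ℕ} {k : ℕ → ℕ} {x a cy cz Sy Sz Ry Rz : ℕ → ℝ} {θ xy Ψyy Ψyz Ψzy Ψzz Ωz σ φ s : ℝ}
    (hy : 16 ≤ y) (hlo : (17/20:ℝ) * y ≤ z) (hhi : (z : ℝ) ≤ (19/20:ℝ) * y) (hzy2 : z + 2 ≤ y)
    (hn : 0 < n) (hk : ∀ l, l < n → y + 1 ≤ k l) (hx : ∀ l, l < n → 0 ≤ x l)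
    (hSy : ∀ l, l < n → Sy l = ∑ m ∈ range y, Real.sqrt ((k l : ℝ) / ((k l : ℝ) + m + 1)))
    (hSz : ∀ l, l < n → Sz l = ∑ m ∈ range z, Real.sqrt ((k l : ℝ) / ((k l : ℝ) + m + 1)))
    (hRy : ∀ l, l < n → Ry l = ∑ m ∈ range (k l), Real.sqrt ((y : ℝ) / ((y : ℝ) + m + 1)))
    (hRz : ∀ l, l < n → Rz l = ∑ m ∈ range (k l), Real.sqrt ((z : ℝ) / ((z : ℝ) + m + 1)))
    (ha0 : ∀ i, i < n → 0 < a i)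
    (ha : ∀ i, i < n → a i = 1 + ∑ l ∈ range n,
      (2 * x l * (∑ m ∈ range (k i), Real.sqrt ((k l : ℝ) / ((k l : ℝ) + m + 1))) / k l) * a l)
    (hcy : ∀ i, i < n → cy i = Ry i / (y : ℝ) + ∑ l ∈ range n,
      (2 * x l * (∑ m ∈ range (k i), Real.sqrt ((k l : ℝ) / ((k l : ℝ) + m + 1))) / k l) * cy l)
    (hcz : ∀ i, i < n → cz i = Rz i / (z : ℝ) + ∑ l ∈ range n,
      (2 * x l * (∑ m ∈ range (k i), Real.sqrt ((k l : ℝ) / ((k l : ℝ) + m + 1))) / k l) * cz l)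
    (hΨyy : Ψyy = ∑ l ∈ range n, (2 * x l * Sy l / k l) * cy l) (hΨyz : Ψyz = ∑ l ∈ range n, (2 * x l * Sz l / k l) * cy l)
    (hΨzy : Ψzy = ∑ l ∈ range n, (2 * x l * Sy l / k l) * cz l) (hΨzz : Ψzz = ∑ l ∈ range n, (2 * x l * Sz l / k l) * cz l)
    (hΩz : Ωz = ∑ l ∈ range n, x l * (z : ℝ) / k l)
    (hσ : σ = (∑ m ∈ range z, Real.sqrt ((y : ℝ) / ((y : ℝ) + m + 1))) / (y : ℝ))
    (hφ : φ = (∑ m ∈ range y, Real.sqrt ((z : ℝ) / ((z : ℝ) + m + 1))) / (z : ℝ))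
    (hs : s = (∑ m ∈ range y, Real.sqrt ((y : ℝ) / ((y : ℝ) + m + 1))) / (y : ℝ))
    (hθ : θ ≤ 1 - ((y : ℝ) / z) / ((y : ℝ) / z + 1) * Real.sqrt (((y : ℝ) / z) / ((y : ℝ) / z + 1)) * Real.exp (-(1 / (2 * ((y : ℝ) / z)))))
    (hxy : 0 ≤ xy) (hcap : 2 * xy * (s + Ψyy) < 1) :
    (1 + 2 * (31/40:ℝ) * Ψzz) * (1 - Ωz) - (1 - θ) * (xy * (1 + 2 * (31/40:ℝ) * Ψyy))
      ≤ (1 - xy * (1 + 2 * (31/40:ℝ) * Ψyy)) *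
        ((1 + 2 * (31/40:ℝ) * Ψzz + 4 * (31/40:ℝ) * xy * ((σ + Ψyz) * (φ + Ψzy)) / (1 - 2 * (s + Ψyy) * xy)) * ((1 - Ωz) - xy / ((y : ℝ) / (z : ℝ)))) := by
  have hy' : (16 : ℝ) ≤ y := by exact_mod_cast hy
  have hz1 : 1 ≤ z := by
    by_contra h
    have : (z : ℝ) ≤ 0 := by exact_mod_cast (show z ≤ 0 by omega)
    linarith
  have hzp : (0 : ℝ) < z := by exact_mod_cast (show 0 < z by omega)
  have hzy : z + 1 ≤ y := by omega
  have hq1 : (1 : ℝ) ≤ (y : ℝ) / z := by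
    rw [le_div_iff₀ hzp]
    have : (z : ℝ) + 1 ≤ y := by exact_mod_cast hzy
    linarith
  by_cases c0 : (z : ℝ) ≤ (9/10:ℝ) * y
  · have hzlo : 14 ≤ z := by
      by_contra h
      have : (z : ℝ) ≤ 13 := by exact_mod_cast (show z ≤ 13 by omega)
      linarith [show (17/20:ℝ) * (y : ℝ) ≤ z from hlo]
    exact band_pair_step_lattice_half (rl := (17/20:ℝ)) (rh := (9/10:ℝ)) (y0 := 16) (z0 := 14) (th := (491/625:ℝ)) (by norm_num) (by norm_num) (by omega) hzlo hz1 hzy hlo c0 Summit.QuantumFields.BalabanUV.Beta.EriceRemainderEnclosureHistoryAutonomyComparisonAgeCompositionStaticChainBandsJ.facts_low_17_20_to_9_10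
      hn hk hx hSy hSz hRy hRz ha0 ha hcy hcz hΨyy hΨyz hΨzy hΨzz hΩz hσ hφ hs
      (hθ.trans (thetabar_le_envelope hq1)) hxy hcap
  have hzlo : 15 ≤ z := by
    by_contra h
    have : (z : ℝ) ≤ 14 := by exact_mod_cast (show z ≤ 14 by omega)
    linarith [show (9/10:ℝ) * (y : ℝ) ≤ z from (not_le.mp c0).le]
  exact band_pair_step_lattice_half (rl := (9/10:ℝ)) (rh := (19/20:ℝ)) (y0 := 16) (z0 := 15) (th := (491/625:ℝ)) (by norm_num) (by norm_num) (by omega) hzlo hz1 hzy (not_le.mp c0).le hhi Summit.QuantumFields.BalabanUV.Beta.EriceRemainderEnclosureHistoryAutonomyComparisonAgeCompositionStaticChainBandsJ.facts_low_9_10_to_19_20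
    hn hk hx hSy hSz hRy hRz ha0 ha hcy hcz hΨyy hΨyz hΨzy hΨzz hΩz hσ hφ hs
    (hθ.trans (thetabar_le_envelope hq1)) hxy hcap


end Summit.QuantumFields.BalabanUV.Beta.EriceRemainderEnclosureHistoryAutonomyComparisonAgeCompositionStaticChainBandsLow

end
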